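import Mathlib
import HarnessLib
import Summits.CriticalPhenomena.CardyFormulaZ2.Theses.CardySelfRefinement
import Summits.CriticalPhenomena.CardyFormulaZ2.Theorems.CardySelfRefinementSymmetryUpgradeRExitTransfer
import Summits.CriticalPhenomena.CardyFormulaZ2.Theorems.CardySelfRefinementSymmetryUpgradeRExitFlatWallChart
import Literature.Probability.RandomPlanarGeometry.ChordalReversibility
import Literature.Probability.RandomPlanarGeometry.ConformalRectangle
import Literature.Probability.RandomPlanarGeometry.IsometryCovariance

/-!
# Crux `SymmetryUpgradeR` (stmt-CriticalPhenomena-17239), line `SketchIdeatorTwo` — helper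
# `exitRigidity_exitFunction_le_rpow` for stub `stub_exitRigidity` (FL4): `F_P(η) = O(η^{1/3})`

Third rung of the reduction of S4 to the exit function `F_P`: **the modulus of the dent rectangles
at a locally flat boundary point is comparable to their Euclidean size**
(`exitRigidity_flatWall_crossRatio`), hence **the touch upper bound `P_D(γ meets B(z, ε)) ≤ C ε^{1/3}`
at ONE flat boundary point forces `F_P(η) ≤ C' η^{1/3}` for all small moduli**
(`exitRigidity_exitFunction_le_rpow`), for chordal, conformally covariant, isometry covariant,
target independent `P`. Mechanism: in the flat-wall boundary chart (`exitRigidity_flatWallChart`,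
Schwarz reflection: the inverse chart is a holomorphic `G` across the wall, real on it,
`G′(0) ≠ 0`) the dent rectangle `(Ω; a, b, z − σeu, z + σeu)` (`exists_dentParams`, `e = ε/2`) is
uniformized with real marks `(g 0, g m₁, G(−σe), G(σe))`, so its modulus
`η(ε) = (x₀ − x₁)(G(−σe) − G(σe)) / ((x₀ − G(−σe))(x₁ − G(σe)))` is continuous in `ε`, vanishes at
`0`, and is pinned between `c₁ ε` and `c₂ ε` (mean value theorem, `x₀, x₁, G(0)` distinct); every
small modulus is then a dent modulus (intermediate values) and
`F_P(η) = h_P(R_ε) ≤ P_D(U_ε(z)) ≤ C ε^{1/3} ≤ C c₁^{-1/3} η^{1/3}`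
(`exitRigidity_exitFunctionOfModulus_isometry`, `exitRigidity_exitFunction_le_touch`).
References: Ahlfors, *Complex Analysis* (1979) Ch. 4 §6.5; Pommerenke, *Boundary Behaviour of
Conformal Maps* (1992) Thm. 2.6; Werner, *Lectures on 2D critical percolation* (2007) §3.
-/

noncomputable section

namespace Summit.CriticalPhenomena.CardyFormulaZ2.Theorems.SymmetryUpgradeR.SwallowingSkeleton

open MeasureTheory Filter Set Metric Topology Complex
open Literature.Probability.RandomPlanarGeometry Literature.Probability.LatticeModels
  Literature.Probability.Percolation
open UpperHalfPlane (upperHalfPlaneSet)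
open scoped ComplexConjugate

/-! ### Two-sided increments of a real function with derivative near a non-zero constant -/

/-- **Bi-Lipschitz increments from a derivative pinned near `d ≠ 0`.** If `f` has derivative `f′`
on `(-ρ, ρ)` with `|f′ − d| ≤ |d|/2`, then `(|d|/2)|b − a| ≤ |f b − f a| ≤ (3|d|/2)|b − a|` for
`a, b ∈ (-ρ, ρ)` (mean value theorem). -/
theorem abs_sub_two_sided {f f' : ℝ → ℝ} {d ρ : ℝ}
    (hf : ∀ τ, |τ| < ρ → HasDerivAt f (f' τ) τ) (hf' : ∀ τ, |τ| < ρ → |f' τ - d| ≤ |d| / 2)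
    {a b : ℝ} (ha : |a| < ρ) (hb : |b| < ρ) :
    |d| / 2 * |b - a| ≤ |f b - f a| ∧ |f b - f a| ≤ 3 * |d| / 2 * |b - a| := by
  have key : ∀ a b : ℝ, |a| < ρ → |b| < ρ → a < b →
      |d| / 2 * |b - a| ≤ |f b - f a| ∧ |f b - f a| ≤ 3 * |d| / 2 * |b - a| := by
    intro a b ha hb hab
    have hin : ∀ τ ∈ Icc a b, |τ| < ρ := fun τ hτ => by
      rw [abs_lt] at ha hb ⊢
      exact ⟨by linarith [hτ.1], by linarith [hτ.2]⟩
    have hcont : ContinuousOn f (Icc a b) := fun τ hτ =>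
      (hf τ (hin τ hτ)).continuousAt.continuousWithinAt
    obtain ⟨c, hc, hceq⟩ := exists_hasDerivAt_eq_slope f f' hab hcont
      fun τ hτ => hf τ (hin τ (Ioo_subset_Icc_self hτ))
    have hba : 0 < b - a := sub_pos.2 hab
    have hfba : f b - f a = f' c * (b - a) := by
      rw [hceq, div_mul_cancel₀ _ hba.ne']
    have hc' := hf' c (hin c (Ioo_subset_Icc_self hc))
    have h1 : |d| / 2 ≤ |f' c| := by
      have := abs_sub_abs_le_abs_sub d (f' c)
      rw [abs_sub_comm] at hc'
      linarith
    have h2 : |f' c| ≤ 3 * |d| / 2 := by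
      have := abs_sub_abs_le_abs_sub (f' c) d
      linarith
    rw [hfba, abs_mul, abs_of_pos hba]
    exact ⟨mul_le_mul_of_nonneg_right h1 hba.le, mul_le_mul_of_nonneg_right h2 hba.le⟩
  rcases lt_trichotomy a b with hab | rfl | hba
  · exact key a b ha hb hab
  · simp
  · obtain ⟨h1, h2⟩ := key b a hb ha hba
    rw [abs_sub_comm (f a), abs_sub_comm a] at h1 h2
    exact ⟨h1, h2⟩

/-! ### Cross-ratio asymptotics of the dent rectangles at a flat wall -/

/-- **The modulus of a dent rectangle at a flat wall is comparable to its size.** Let the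
Dobrushin domain `D = (Ω; a, b)` be flat near the interior point `z` of its free arc
(`Ω ∩ B(z, r)` the open half-disc on the left of the unit direction `u`). There are a function
`η`, continuous on `[0, ε₀]` with `η(0) = 0`, and constants `0 < c₁ ≤ c₂` such that for every
`0 < ε < ε₀`: `c₁ ε ≤ η(ε) ≤ c₂ ε`, and there is a conformal rectangle `R_ε = (Ω; a, b, c, d)` on
`D` with `z ∈ (cd) ⊆ B(z, ε)` and a uniformizing datum of cross-ratio exactly `η(ε)`. -/
theorem exitRigidity_flatWall_crossRatio (D : DobrushinDomain) {z u : ℂ} {r : ℝ}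
    (hz : z ∈ D.arc 1) (hz0 : z ≠ D.pt 0) (hz1 : z ≠ D.pt 1) (hu : ‖u‖ = 1) (hr : 0 < r)
    (hflat : D.carrier ∩ ball z r = {w | w ∈ ball z r ∧ 0 < (conj u * (w - z)).im}) :
    ∃ (η : ℝ → ℝ) (c₁ c₂ ε₀ : ℝ), 0 < c₁ ∧ 0 < ε₀ ∧ ContinuousOn η (Icc 0 ε₀) ∧ η 0 = 0 ∧
      ∀ ε ∈ Ioo 0 ε₀, c₁ * ε ≤ η ε ∧ η ε ≤ c₂ * ε ∧
        ∃ (R : ConformalRectangle) (φ : ConformalEquiv upperHalfPlaneSet R.carrier)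
          (x : Fin 4 → ℝ), R.carrier = D.carrier ∧ R.pt 0 = D.pt 0 ∧ R.pt 1 = D.pt 1 ∧
          z ∈ R.arc 2 ∧ R.arc 2 ⊆ ball z ε ∧ R.IsUniformizing φ x ∧ crossRatio x = η ε := by
  have h01 : D.mark 0 < D.mark 1 := D.mark_zero_lt_mark_one
  obtain ⟨t, ht₁, ht₂, hzt⟩ := exists_param_of_mem_arc_one D hz hz0 hz1
  -- the boundary loop re-based at `a` (the Jordan domain of any dent rectangle)
  obtain ⟨R₀, hJc, hJb', -⟩ := exists_dentRectangle D (s₂ := t) (s₃ := (t + (D.mark 0 + 1)) / 2)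
    ht₁ (by linarith) (by linarith)
  set J : JordanDomain := R₀.toJordanDomain with hJdef
  have hJb : ∀ s, J.boundary s = D.boundary (s + D.mark 0) := fun s => congrFun hJb' s
  -- parameters of `b` and `z` on the re-based loop, and the base point of the chart
  set m₁ : ℝ := D.mark 1 - D.mark 0 with hm₁def
  set t' : ℝ := t - D.mark 0 with ht'def
  have hm₁pos : 0 < m₁ := by rw [hm₁def]; linarith
  have ht'₁ : m₁ < t' := by rw [hm₁def, ht'def]; linarith
  have ht'₂ : t' < 1 := by rw [ht'def]; linarith
  have hzt' : J.boundary t' = z := by rw [hJb, ht'def, sub_add_cancel]; exact hzt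
  set t₁ : ℝ := (t' + 1) / 2 with ht₁def
  have ht₁lt : t' < t₁ := by rw [ht₁def]; linarith
  have ht₁1 : t₁ < 1 := by rw [ht₁def]; linarith
  have ht₁0 : 0 ≤ t₁ := by linarith
  have hp₁z : J.boundary t₁ ≠ z := fun h => by
    have := J.injOn_boundary ⟨ht₁0, ht₁1⟩ ⟨by linarith, ht'₂⟩ (h.trans hzt'.symm)
    linarith
  -- shrink the flat ball so that it misses the base point
  set r' : ℝ := min r (dist (J.boundary t₁) z) with hr'def
  have hr' : 0 < r' := lt_min hr (dist_pos.2 hp₁z)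
  have hflat' : J.carrier ∩ ball z r' = {w | w ∈ ball z r' ∧ 0 < (conj u * (w - z)).im} := by
    ext w
    constructor
    · rintro ⟨hw, hwr⟩
      have h : w ∈ D.carrier ∩ ball z r := ⟨hJc ▸ hw, ball_subset_ball (min_le_left _ _) hwr⟩
      rw [hflat] at h
      exact ⟨hwr, h.2⟩
    · rintro ⟨hwr, hpos⟩
      have h : w ∈ {w | w ∈ ball z r ∧ 0 < (conj u * (w - z)).im} :=
        ⟨ball_subset_ball (min_le_left _ _) hwr, hpos⟩
      rw [← hflat, ← hJc] at h
      exact ⟨h.1, hwr⟩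
  have hp₁ : J.boundary t₁ ∉ ball z r' := fun h =>
    lt_irrefl _ ((mem_ball.1 h).trans_le (min_le_right _ _))
  -- the flat-wall boundary chart and the dent parameters
  obtain ⟨φ, g, G, h1, h2, h3, hGd, -, -, hGg, hG0, hG0im⟩ :=
    exitRigidity_flatWallChart J z u r' t₁ hu hr' hflat' hp₁
  obtain ⟨σ, δ, e₀, hσ, hδ, hlo, hhi, he₀, he₀r, hdent⟩ :=
    exists_dentParams (lo := m₁) (hi := t₁) hu hr' hflat' ht'₁ ht₁lt hm₁pos.le ht₁1 hzt'
  have hσabs : |σ| = 1 := by rcases hσ with rfl | rfl <;> norm_num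
  -- all marks live in `[0, t' + δ]`, off the base point; `g` is monotone there
  have hneT : ∀ s ∈ Icc (0 : ℝ) (t' + δ), J.boundary s ≠ J.boundary t₁ := fun s hs h => by
    have := J.injOn_boundary ⟨hs.1, by linarith [hs.2]⟩ ⟨ht₁0, ht₁1⟩ h
    linarith [hs.2]
  have hgc : ContinuousOn g (Icc 0 (t' + δ)) :=
    continuousOn_chart J fun s hs => h2 s (hneT s hs)
  have hgi : InjOn g (Icc 0 (t' + δ)) := fun s hs s' hs' hss' =>
    J.injOn_boundary ⟨hs.1, by linarith [hs.2]⟩ ⟨hs'.1, by linarith [hs'.2]⟩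
      (h3 s s' (hneT s hs) (hneT s' hs') hss')
  have hgm : StrictMonoOn g (Icc 0 (t' + δ)) ∨ StrictAntiOn g (Icc 0 (t' + δ)) :=
    hgc.strictMonoOn_of_injOn_Icc' (by linarith) hgi
  have h0I : (0 : ℝ) ∈ Icc (0 : ℝ) (t' + δ) := ⟨le_rfl, by linarith⟩
  have hm₁I : m₁ ∈ Icc (0 : ℝ) (t' + δ) := ⟨hm₁pos.le, by linarith⟩
  have ht'I : t' ∈ Icc (0 : ℝ) (t' + δ) := ⟨by linarith, by linarith⟩
  -- the three fixed real points
  set x₀ : ℝ := g 0 with hx₀def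
  set x₁ : ℝ := g m₁ with hx₁def
  set ξ : ℝ := g t' with hξdef
  have hx01 : x₀ ≠ x₁ := fun h => absurd (hgi h0I hm₁I h) hm₁pos.ne
  have hx0ξ : x₀ ≠ ξ := fun h => absurd (hgi h0I ht'I h) (by linarith)
  have hx1ξ : x₁ ≠ ξ := fun h => absurd (hgi hm₁I ht'I h) ht'₁.ne
  -- the real trace of `G` on the diameter
  set gR : ℝ → ℝ := fun τ => (G τ).re with hgRdef
  have hmemτ : ∀ τ : ℝ, |τ| < r' → (τ : ℂ) ∈ ball (0 : ℂ) r' := fun τ hτ => by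
    rw [mem_ball_zero_iff, Complex.norm_real, Real.norm_eq_abs]; exact hτ
  have hgR0 : gR 0 = ξ := by
    have h := hGg 0 t' (by simpa using hr') (by rw [hzt']; simp)
    simp only [hgRdef, Complex.ofReal_zero] at h ⊢
    rw [h, Complex.ofReal_re]
  have hgRd : ∀ τ : ℝ, |τ| < r' → HasDerivAt gR ((deriv G τ).re) τ := fun τ hτ =>
    ((hGd.differentiableAt (isOpen_ball.mem_nhds (hmemτ τ hτ))).hasDerivAt).real_of_complex
  have hgRc : ∀ τ : ℝ, |τ| < r' → ContinuousAt gR τ := fun τ hτ => (hgRd τ hτ).continuousAt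
  -- the derivative pinned near `d = G′(0) ≠ 0`
  set d : ℝ := (deriv G 0).re with hddef
  have hd : d ≠ 0 := fun h => hG0 (Complex.ext (by simpa [hddef] using h) (by simpa using hG0im))
  have hdpos : 0 < |d| := abs_pos.2 hd
  have hG'c : ContinuousAt (deriv G) 0 :=
    (hGd.analyticOnNhd isOpen_ball).deriv.continuousOn.continuousAt
      (isOpen_ball.mem_nhds (mem_ball_self hr'))
  obtain ⟨ρ₁, hρ₁, hρ₁b⟩ : ∃ ρ₁ > 0, ∀ τ : ℝ, |τ| < ρ₁ → |(deriv G τ).re - d| ≤ |d| / 2 := by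
    obtain ⟨ρ₁, hρ₁, h⟩ := Metric.continuousAt_iff.1 hG'c (|d| / 2) (by positivity)
    refine ⟨ρ₁, hρ₁, fun τ hτ => ?_⟩
    have h' : dist (deriv G τ) (deriv G 0) < |d| / 2 :=
      h (by rw [dist_eq_norm, sub_zero, Complex.norm_real, Real.norm_eq_abs]; exact hτ)
    rw [dist_eq_norm] at h'
    calc |(deriv G τ).re - d| = |(deriv G τ - deriv G 0).re| := by rw [hddef, Complex.sub_re]
      _ ≤ ‖deriv G τ - deriv G 0‖ := Complex.abs_re_le_norm _
      _ ≤ |d| / 2 := h'.le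
  -- `gR` pinned near `ξ`
  set m : ℝ := min |x₀ - ξ| |x₁ - ξ| with hmdef
  have hmpos : 0 < m := lt_min (abs_pos.2 (sub_ne_zero.2 hx0ξ)) (abs_pos.2 (sub_ne_zero.2 hx1ξ))
  obtain ⟨ρ₂, hρ₂, hρ₂b⟩ : ∃ ρ₂ > 0, ∀ τ : ℝ, |τ| < ρ₂ → |gR τ - ξ| ≤ m / 2 := by
    obtain ⟨ρ₂, hρ₂, h⟩ := Metric.continuousAt_iff.1 (hgRc 0 (by simpa using hr')) (m / 2)
      (by positivity)
    refine ⟨ρ₂, hρ₂, fun τ hτ => ?_⟩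
    have h' := h (by rw [Real.dist_eq, sub_zero]; exact hτ)
    rw [Real.dist_eq, hgR0] at h'
    exact h'.le
  -- the size threshold and the modulus function
  set ε₀ : ℝ := min e₀ (min ρ₁ ρ₂) with hε₀def
  have hε₀pos : 0 < ε₀ := lt_min he₀ (lt_min hρ₁ hρ₂)
  have hε₀e : ε₀ ≤ e₀ := min_le_left _ _
  have hε₀ρ₁ : ε₀ ≤ ρ₁ := (min_le_right _ _).trans (min_le_left _ _)
  have hε₀ρ₂ : ε₀ ≤ ρ₂ := (min_le_right _ _).trans (min_le_right _ _)
  have hsmall : ∀ ε ∈ Icc (0 : ℝ) ε₀, ∀ s : ℝ, |s| = 1 →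
      |s * (ε / 2)| < e₀ ∧ |s * (ε / 2)| < ρ₁ ∧ |s * (ε / 2)| < ρ₂ ∧ |s * (ε / 2)| < r' := by
    intro ε hε s hs
    have h : |s * (ε / 2)| = ε / 2 := by rw [abs_mul, hs, one_mul, abs_of_nonneg (by linarith [hε.1])]
    rw [h]
    refine ⟨by linarith [hε.2], by linarith [hε.2], by linarith [hε.2], by linarith [hε.2]⟩
  have hσneg : |(-σ)| = 1 := by rw [abs_neg, hσabs]
  set η : ℝ → ℝ := fun ε =>
    (x₀ - x₁) * (gR (-σ * (ε / 2)) - gR (σ * (ε / 2))) /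
      ((x₀ - gR (-σ * (ε / 2))) * (x₁ - gR (σ * (ε / 2)))) with hηdef
  -- denominators pinned
  have hpin : ∀ (y s : ℝ), |s| = 1 → m ≤ |y - ξ| → ∀ ε ∈ Icc (0 : ℝ) ε₀,
      |y - ξ| / 2 ≤ |y - gR (s * (ε / 2))| ∧ |y - gR (s * (ε / 2))| ≤ 3 * |y - ξ| / 2 := by
    intro y s hs hm' ε hε
    have h := hρ₂b _ (hsmall ε hε s hs).2.2.1
    have e1 := abs_sub_abs_le_abs_sub (y - ξ) (gR (s * (ε / 2)) - ξ)
    have e2 := abs_add_le (y - ξ) (ξ - gR (s * (ε / 2)))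
    rw [show y - ξ - (gR (s * (ε / 2)) - ξ) = y - gR (s * (ε / 2)) by ring] at e1
    rw [show y - ξ + (ξ - gR (s * (ε / 2))) = y - gR (s * (ε / 2)) by ring, abs_sub_comm ξ] at e2
    constructor <;> linarith
  have hden₀ := hpin x₀ (-σ) hσneg (min_le_left _ _)
  have hden₁ := hpin x₁ σ hσabs (min_le_right _ _)
  have hA : 0 < |x₀ - ξ| := abs_pos.2 (sub_ne_zero.2 hx0ξ)
  have hB : 0 < |x₁ - ξ| := abs_pos.2 (sub_ne_zero.2 hx1ξ)
  have hK : 0 < |x₀ - x₁| := abs_pos.2 (sub_ne_zero.2 hx01)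
  -- numerator pinned (mean value theorem)
  have hnum : ∀ ε ∈ Icc (0 : ℝ) ε₀, |d| / 2 * ε ≤ |gR (-σ * (ε / 2)) - gR (σ * (ε / 2))| ∧
      |gR (-σ * (ε / 2)) - gR (σ * (ε / 2))| ≤ 3 * |d| / 2 * ε := by
    intro ε hε
    have ha := hsmall ε hε _ hσabs
    have hb := hsmall ε hε _ hσneg
    have key := abs_sub_two_sided (f := gR) (f' := fun τ => (deriv G τ).re) (d := d)
      (ρ := min ρ₁ r') (fun τ hτ => hgRd τ (hτ.trans_le (min_le_right _ _)))
      (fun τ hτ => hρ₁b τ (hτ.trans_le (min_le_left _ _))) (a := σ * (ε / 2))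
      (b := -σ * (ε / 2)) (lt_min ha.2.1 ha.2.2.2) (lt_min hb.2.1 hb.2.2.2)
    have hdiff : |-σ * (ε / 2) - σ * (ε / 2)| = ε := by
      rw [show -σ * (ε / 2) - σ * (ε / 2) = -(σ * ε) by ring, abs_neg, abs_mul, hσabs, one_mul,
        abs_of_nonneg hε.1]
    rw [hdiff] at key
    exact key
  have hP₁ : 0 < 3 * |x₀ - ξ| / 2 * (3 * |x₁ - ξ| / 2) := mul_pos (by linarith) (by linarith)
  have hP₂ : 0 < |x₀ - ξ| / 2 * (|x₁ - ξ| / 2) := mul_pos (by linarith) (by linarith)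
  refine ⟨η, |x₀ - x₁| * (|d| / 2) / (3 * |x₀ - ξ| / 2 * (3 * |x₁ - ξ| / 2)),
    |x₀ - x₁| * (3 * |d| / 2) / (|x₀ - ξ| / 2 * (|x₁ - ξ| / 2)), ε₀,
    div_pos (mul_pos hK (by linarith)) hP₁, hε₀pos, ?_, ?_, fun ε hε => ?_⟩
  · -- continuity of the modulus function
    have hcomp : ∀ s : ℝ, |s| = 1 → ContinuousOn (fun ε : ℝ => gR (s * (ε / 2))) (Icc 0 ε₀) := by
      intro s hs ε hε
      have h1 : ContinuousAt (fun ε : ℝ => s * (ε / 2)) ε := by fun_prop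
      exact ((hgRc _ (hsmall ε hε s hs).2.2.2).comp_of_eq h1 rfl).continuousWithinAt
    refine ContinuousOn.div (continuousOn_const.mul ((hcomp _ hσneg).sub (hcomp _ hσabs)))
      ((continuousOn_const.sub (hcomp _ hσneg)).mul (continuousOn_const.sub (hcomp _ hσabs)))
      fun ε hε => mul_ne_zero ?_ ?_
    · exact abs_pos.1 (lt_of_lt_of_le (by positivity) (hden₀ ε hε).1)
    · exact abs_pos.1 (lt_of_lt_of_le (by positivity) (hden₁ ε hε).1)
  · -- `η(0) = 0`
    simp only [hηdef, zero_div, mul_zero, sub_self, zero_div]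
  -- a positive size `ε < ε₀`
  have hεI : ε ∈ Icc (0 : ℝ) ε₀ := ⟨hε.1.le, hε.2.le⟩
  have he : ε / 2 ∈ Ioo 0 e₀ := ⟨by linarith [hε.1], by linarith [hε.2, hε₀e]⟩
  obtain ⟨s₂, s₃, hs₂, hs₂t, hts₃, hs₃, hbs₂, hbs₃, hball⟩ := hdent (ε / 2) he
  -- the dent rectangle
  let R : ConformalRectangle :=
    { toJordanDomain := J
      mark := ![0, m₁, s₂, s₃]
      strictMono_mark := by
        refine Fin.strictMono_iff_lt_succ.2 fun k => ?_
        fin_cases k <;> simp <;> linarith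
      mark_mem := by
        intro k
        fin_cases k <;> simp <;> (try constructor) <;> linarith }
  have hmarkI : ∀ i, R.mark i ∈ Icc (0 : ℝ) (t' + δ) := by
    intro i
    fin_cases i <;> simp [R] <;> (try constructor) <;> linarith
  set x : Fin 4 → ℝ := fun i => g (R.mark i) with hxdef
  have hx2 : g s₂ = gR (-σ * (ε / 2)) := by
    have h := hGg (-σ * (ε / 2)) s₂ (hsmall ε hεI _ hσneg).2.2.2 (by rw [hbs₂]; push_cast; ring)
    simp only [hgRdef]; rw [h, Complex.ofReal_re]
  have hx3 : g s₃ = gR (σ * (ε / 2)) := by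
    have h := hGg (σ * (ε / 2)) s₃ (hsmall ε hεI _ hσabs).2.2.2 (by rw [hbs₃])
    simp only [hgRdef]; rw [h, Complex.ofReal_re]
  have hcr : crossRatio x = η ε := by
    show (g 0 - g m₁) * (g s₂ - g s₃) / ((g 0 - g s₂) * (g m₁ - g s₃)) = _
    rw [hx2, hx3]
  have huni : R.IsUniformizing φ x := by
    refine ⟨?_, fun i => h1 (R.mark i) (hneT _ (hmarkI i))⟩
    exact hgm.imp (fun h i j hij => h (hmarkI i) (hmarkI j) (R.strictMono_mark hij))
      (fun h i j hij => h (hmarkI i) (hmarkI j) (R.strictMono_mark hij))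
  have hηpos : 0 < η ε := by
    rw [← hcr]; exact (crossRatio_mem_Ioo huni.1).1
  -- the two-sided bound
  have hηabs : |η ε| = |x₀ - x₁| * |gR (-σ * (ε / 2)) - gR (σ * (ε / 2))| /
      (|x₀ - gR (-σ * (ε / 2))| * |x₁ - gR (σ * (ε / 2))|) := by
    simp only [hηdef, abs_div, abs_mul]
  obtain ⟨hn₁, hn₂⟩ := hnum ε hεI
  obtain ⟨hd₀₁, hd₀₂⟩ := hden₀ ε hεI
  obtain ⟨hd₁₁, hd₁₂⟩ := hden₁ ε hεI
  have hD₀ : 0 < |x₀ - gR (-σ * (ε / 2))| := lt_of_lt_of_le (by positivity) hd₀₁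
  have hD₁ : 0 < |x₁ - gR (σ * (ε / 2))| := lt_of_lt_of_le (by positivity) hd₁₁
  have harc2 : R.arc 2 = J.boundary '' Icc s₂ s₃ := by
    rw [MarkedDomain.arc, R.nextMark_of_lt 2 (by decide)]; rfl
  refine ⟨?_, ?_, R, φ, x, hJc, ?_, ?_, ?_, ?_, huni, hcr⟩
  · rw [← abs_of_pos hηpos, hηabs, div_mul_eq_mul_div, div_le_div_iff₀ hP₁ (mul_pos hD₀ hD₁)]
    calc |x₀ - x₁| * (|d| / 2) * ε * (|x₀ - gR (-σ * (ε / 2))| * |x₁ - gR (σ * (ε / 2))|)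
        ≤ |x₀ - x₁| * (|d| / 2) * ε * (3 * |x₀ - ξ| / 2 * (3 * |x₁ - ξ| / 2)) :=
          mul_le_mul_of_nonneg_left (mul_le_mul hd₀₂ hd₁₂ hD₁.le (by positivity))
            (mul_nonneg (by positivity) hε.1.le)
      _ = |x₀ - x₁| * (|d| / 2 * ε) * (3 * |x₀ - ξ| / 2 * (3 * |x₁ - ξ| / 2)) := by ring
      _ ≤ |x₀ - x₁| * |gR (-σ * (ε / 2)) - gR (σ * (ε / 2))| *
          (3 * |x₀ - ξ| / 2 * (3 * |x₁ - ξ| / 2)) :=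
          mul_le_mul_of_nonneg_right (mul_le_mul_of_nonneg_left hn₁ (abs_nonneg _)) hP₁.le
  · rw [← abs_of_pos hηpos, hηabs, div_mul_eq_mul_div, div_le_div_iff₀ (mul_pos hD₀ hD₁) hP₂]
    calc |x₀ - x₁| * |gR (-σ * (ε / 2)) - gR (σ * (ε / 2))| * (|x₀ - ξ| / 2 * (|x₁ - ξ| / 2))
        ≤ |x₀ - x₁| * (3 * |d| / 2 * ε) * (|x₀ - ξ| / 2 * (|x₁ - ξ| / 2)) :=
          mul_le_mul_of_nonneg_right (mul_le_mul_of_nonneg_left hn₂ (abs_nonneg _)) hP₂.le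
      _ = |x₀ - x₁| * (3 * |d| / 2) * ε * (|x₀ - ξ| / 2 * (|x₁ - ξ| / 2)) := by ring
      _ ≤ |x₀ - x₁| * (3 * |d| / 2) * ε *
          (|x₀ - gR (-σ * (ε / 2))| * |x₁ - gR (σ * (ε / 2))|) :=
          mul_le_mul_of_nonneg_left (mul_le_mul hd₀₁ hd₁₁ (by positivity) hD₀.le)
            (mul_nonneg (by positivity) hε.1.le)
  · show J.boundary 0 = D.boundary (D.mark 0)
    rw [hJb, zero_add]
  · show J.boundary m₁ = D.boundary (D.mark 1)
    rw [hJb, hm₁def, sub_add_cancel]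
  · rw [harc2, ← hzt']
    exact ⟨t', ⟨hs₂t.le, hts₃.le⟩, rfl⟩
  · rw [harc2]
    rintro _ ⟨s, hs, rfl⟩
    rw [mem_ball]
    exact (hball s hs).trans_lt (by linarith [hε.1])

/-! ### The exit function is `O(η^{1/3})` -/

/-- Registered helper `exitRigidity_exitFunction_le_rpow` (for stub `stub_exitRigidity`, line
`SketchIdeatorTwo` of crux stmt-CriticalPhenomena-17239). **The flat-wall touch upper bound pins the
small-modulus growth of the exit function.** Let `P` be chordal, conformally covariant, isometry
covariant and target independent, and suppose that at an interior point `z` of the free arc of a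
Dobrushin domain `D`, near which `D` is an open half-disc, `P_D(γ meets B(z, ε)) ≤ C ε^{1/3}` for
`0 < ε < ε₁`. Then there are `C'` and `η₀ > 0` such that every conformal rectangle `S` (on any
domain) with a uniformizing datum of cross-ratio `η ≤ η₀` has exit probability
`h_P(S) = P_{(Ω; a, c)}((cd) before (bc)) ≤ C' η^{1/3}`: in terms of the exit function,
`F_P(η) ≤ C' η^{1/3}` as `η → 0⁺` — the upper half of "`TouchExponentOneThird ⟹ F_P(η) ≍ η^{1/3}`"
(dent inequality `exitRigidity_exitFunction_le_touch`, dent moduli `≍ ε` by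
`exitRigidity_flatWall_crossRatio`, intermediate values in `ε`, and
`exitRigidity_exitFunctionOfModulus_isometry`). -/
theorem exitRigidity_exitFunction_le_rpow : ∀ P : ChordalFamily, P.IsChordal → P.IsConformallyCovariant → P.IsIsometryCovariant → P.IsTargetIndependent → ∀ (D : DobrushinDomain) (z u : ℂ) (r C ε₁ : ℝ), z ∈ D.arc 1 → z ≠ D.pt 0 → z ≠ D.pt 1 → ‖u‖ = 1 → 0 < r → D.carrier ∩ Metric.ball z r = {w | w ∈ Metric.ball z r ∧ 0 < ((starRingEnd ℂ) u * (w - z)).im} → 0 < ε₁ → (∀ ε ∈ Set.Ioo 0 ε₁, (P D).real {γ | ∃ w ∈ γ.range, dist w z < ε} ≤ C * ε ^ (1 / 3 : ℝ)) → ∃ C' η₀ : ℝ, 0 < η₀ ∧ ∀ (S : ConformalRectangle) (ψ : ConformalEquiv upperHalfPlaneSet S.carrier) (y : Fin 4 → ℝ), S.IsUniformizing ψ y → crossRatio y ≤ η₀ → (P (S.chord 0 2 (by decide))).real (CurveClass.hitsBefore (S.arc 2) (S.arc 1)) ≤ C' * crossRatio y ^ (1 / 3 : ℝ) := by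
  intro P hP hcov hiso hTI D z u r C ε₁ hz hz0 hz1 hu hr hflat hε₁ htouch
  obtain ⟨η, c₁, c₂, ε₀, hc₁, hε₀, hηc, hη0, hdent⟩ :=
    exitRigidity_flatWall_crossRatio D hz hz0 hz1 hu hr hflat
  -- a reference size below both thresholds
  set ε' : ℝ := min (ε₀ / 2) (ε₁ / 2) with hε'def
  have hε'pos : 0 < ε' := lt_min (by linarith) (by linarith)
  have hε'₀ : ε' < ε₀ := (min_le_left _ _).trans_lt (by linarith)
  have hε'₁ : ε' < ε₁ := (min_le_right _ _).trans_lt (by linarith)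
  obtain ⟨hlow', -, -⟩ := hdent ε' ⟨hε'pos, hε'₀⟩
  have hη₀ : 0 < η ε' := lt_of_lt_of_le (by positivity) hlow'
  refine ⟨max C 0 / c₁ ^ (1 / 3 : ℝ), η ε', hη₀, fun S ψ y hψ hyle => ?_⟩
  have hypos : 0 < crossRatio y := (ConformalRectangle.crossRatio_mem_Ioo_of_isUniformizing hψ).1
  -- a dent size `ε ≤ ε'` with modulus exactly `crossRatio y` (intermediate values)
  have hiv : crossRatio y ∈ η '' Icc 0 ε' := by
    refine intermediate_value_Icc hε'pos.le (hηc.mono (Icc_subset_Icc_right hε'₀.le)) ⟨?_, hyle⟩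
    rw [hη0]; exact hypos.le
  obtain ⟨ε, hεI, hεy⟩ := hiv
  have hεpos : 0 < ε := lt_of_le_of_ne hεI.1 fun h => by
    rw [← h, hη0] at hεy; exact hypos.ne hεy
  have hε₀' : ε < ε₀ := hεI.2.trans_lt hε'₀
  have hε₁' : ε < ε₁ := hεI.2.trans_lt hε'₁
  obtain ⟨hlow, -, R, φ, x, hc, h0, h1, -, hball, hφ, hcr⟩ := hdent ε ⟨hεpos, hε₀'⟩
  -- `h_P(S) = h_P(R) ≤ P_D(U_ε(z)) ≤ C ε^{1/3}`
  have hmod : crossRatio x = crossRatio y := by rw [hcr, hεy]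
  have hS : (P (S.chord 0 2 (by decide))).real (CurveClass.hitsBefore (S.arc 2) (S.arc 1)) =
      (P (R.chord 0 2 (by decide))).real (CurveClass.hitsBefore (R.arc 2) (R.arc 1)) :=
    (exitRigidity_exitFunctionOfModulus_isometry P hP hcov hiso R S φ ψ x y hφ hψ hmod).symm
  have hle : (P (R.chord 0 2 (by decide))).real (CurveClass.hitsBefore (R.arc 2) (R.arc 1)) ≤
      C * ε ^ (1 / 3 : ℝ) :=
    (exitRigidity_exitFunction_le_touch P hP hcov hTI D R z ε hc h0 h1 hball).trans
      (htouch ε ⟨hεpos, hε₁'⟩)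
  -- `ε ≤ η / c₁`
  have hεle : ε ≤ crossRatio y / c₁ := by
    rw [le_div_iff₀ hc₁, mul_comm, ← hεy]; exact hlow
  have hrpow : ε ^ (1 / 3 : ℝ) ≤ crossRatio y ^ (1 / 3 : ℝ) / c₁ ^ (1 / 3 : ℝ) := by
    rw [← Real.div_rpow hypos.le hc₁.le]
    exact Real.rpow_le_rpow hεpos.le hεle (by norm_num)
  rw [hS]
  calc (P (R.chord 0 2 (by decide))).real (CurveClass.hitsBefore (R.arc 2) (R.arc 1))
      ≤ C * ε ^ (1 / 3 : ℝ) := hle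
    _ ≤ max C 0 * ε ^ (1 / 3 : ℝ) :=
        mul_le_mul_of_nonneg_right (le_max_left _ _) (Real.rpow_nonneg hεpos.le _)
    _ ≤ max C 0 * (crossRatio y ^ (1 / 3 : ℝ) / c₁ ^ (1 / 3 : ℝ)) :=
        mul_le_mul_of_nonneg_left hrpow (le_max_right _ _)
    _ = max C 0 / c₁ ^ (1 / 3 : ℝ) * crossRatio y ^ (1 / 3 : ℝ) := by ring

end Summit.CriticalPhenomena.CardyFormulaZ2.Theorems.SymmetryUpgradeR.SwallowingSkeleton
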